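import Summits.BirchSwinnertonDyer.BirchSwinnertonDyer.Theorems.PrintCFramBottomClassIndexLawFiveLeHerbrandSelmerToHomClass
import Literature.NumberTheory.GaloisRepresentations.DecompositionGroupOfCompletion
import Literature.NumberTheory.GaloisRepresentations.IntegralGaloisActionProofs
import Literature.NumberTheory.GaloisRepresentations.DegreeOnePrimesFixedField
import HarnessLib

/-!
# Crux `PrintCFram.BottomClassIndexLawFiveLe` (stmt-BirchSwinnertonDyer-20372), line `eisenstein-resource-bdp-line` (v10):
# Stub H, typing item T2′ — the socket read in the currency of PRIMES OF `\bar ℤ_K` (`v.primesAbove`,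
# Mathlib `Ideal.inertia` / `Ideal.decompositionSubgroup`)

Cell `bsd-print-cfram`, width seat `bsd-line-cfram-p1-w4` (generation g5), `--supports stmt-BirchSwinnertonDyer-20372` (helper);
third file of the T2′ series (`…HerbrandSelmerToHom.lean` p648816, `…HerbrandSelmerToHomClass.lean` p649370). THEOREMS ONLY; no
definition, no named fact, no `sorry`. BSD is not proved by any of this; no summit statement is proved by this seat; no stub is
closed.

WHY. The socket `HerbrandSelmerToHom.datumStrictSelmer_bdpData_eq_bot_of_forall_hom_of_top` states the local conditions of the
Hom-side with the chosen-embedding groups of `GreenbergSelmer` — «`f` kills `N ∩ σ⁻¹ I_v σ` for all `σ ∈ Γ_K`» (`I_v = inertia v`,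
the image of `I_{K_v}` under `res : Γ_{K_v} → Γ_K`) and «`N ∩ σ⁻¹ D_𝔭 σ`». The ramification dictionary the tree's class-field /
Kummer / Frobenius files speak is the other one: primes `𝔓` of `\bar ℤ_K` above `v` (`v.primesAbove`) with their inertia and
decomposition groups `𝔓.inertia Γ_K`, `𝔓.decompositionSubgroup Γ_K` (Silverman's `Hom(U, M; S)` = tree `unramifiedHoms`, w7's
S-invisibility file 2, LEAD g8's T1 part 3, w8's Kummer files). This file translates: `inertia v = I_{𝔓₀}` and `decomp v = D_{𝔓₀}`
for the prime `𝔓₀ = adicCompletionPrime K v` (tree, Neukirch II (9.6)), conjugates of `𝔓₀` are the primes above `v` (transitivity,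
tree `exists_smul_eq_of_mem_primesAbove_holds`) and `I_{σ⁻¹ 𝔓₀} = σ⁻¹ I_{𝔓₀} σ`; hence

* `datumStrictSelmer_bdpData_eq_bot_of_forall_hom_primesAbove` — **`datumStrictSelmer H M p (bdpData M p 𝔭) S₀ = ⊥`** (for `H ∋`
  every `g`, `M` of prime order with continuous orbit maps and non-trivial action) as soon as every continuous `f : Γ_K → M`,
  additive and `Γ_K`-equivariant on `N = ker(Γ_K → Aut M)`, which kills **`N ∩ I_𝔓` for every prime `𝔓` of `\bar ℤ_K` above every
  finite `v ∉ S₀`, `v ∤ p`** and **`N ∩ D_𝔓` for every `𝔓` above `𝔭`**, vanishes on `N`;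
* `datumStrictSelmer_bdpData_eq_bot_of_forall_hom_character_primesAbove` — the same with `f : Γ_K → ℤ/p` and the character `θ`
  of `M` (`N = ker θ`, `f(g n g⁻¹) = θ(g) f(n)`);
* on the class (Stub H's quantifiers): `bottomResidualSelmer_sub_eq_bot_of_forall_hom_character_primesAbove`,
  `bottomResidualSelmer_quot_eq_bot_of_forall_hom_character_primesAbove`.

Dictionary lemmas (§1): `inertia_eq_inertia_adicCompletionPrime`, `decomp_eq_decompositionSubgroup_adicCompletionPrime`,
`smul_mem_primesAbove`, `conj_mem_inertia_of_mem`, `conj_mem_decompositionSubgroup_of_mem`,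
`forall_primesAbove_inertia_of_forall_conj` / `forall_primesAbove_decompositionSubgroup_of_forall_conj` (the σ-form of a local
vanishing statement implies its prime-form).

References: Neukirch, *Algebraic Number Theory* I §9 (9.1), (9.4), II §9 (9.6); Silverman, *AEC* X.§4 proof of Lemma 4.3
(`Hom(G, M; S)`); Greenberg–Vatsal 2000 §2 pp. 16–17; the herbrand M1 memo §§2–3 (crux workfile).
-/

noncomputable section

-- summit-side namespace `Summit.BirchSwinnertonDyer.BirchSwinnertonDyer.…` (single-conjunct summit, D-0017 layout)
set_option linter.dupNamespace false
set_option autoImplicit false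

open scoped Classical Pointwise
open NumberField WeierstrassCurve IsDedekindDomain Field
open Literature.NumberTheory.EllipticCurves
open Literature.NumberTheory.EllipticCurves.GreenbergSelmer
open Literature.NumberTheory.EllipticCurves.GreenbergVatsal2000
open Literature.NumberTheory.GaloisRepresentations
open Summit.BirchSwinnertonDyer.Rank1Residual
open Summit.BirchSwinnertonDyer.Rank1Residual.X11b

namespace Summit.BirchSwinnertonDyer.BirchSwinnertonDyer.Theorems.PrintCFram.HerbrandSelmerToHom

/-! ## §1 The dictionary: chosen-embedding groups ↔ primes of `\bar ℤ_K` -/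

section Dictionary

variable {K : Type} [Field K] [NumberField K] (v : HeightOneSpectrum (𝓞 K))

/-- **`I_v = I_{𝔓₀}`**: the `GreenbergSelmer` inertia group at `v` (image of `I_{K_v}` under the restriction along the chosen
embedding) is the inertia group of the prime `𝔓₀ = adicCompletionPrime K v` of `\bar ℤ_K` cut out by that embedding (tree,
Neukirch II (9.6)). [cite: NeukirchANT1999, Ch. II §9 Prop. (9.6)] -/
theorem inertia_eq_inertia_adicCompletionPrime :
    inertia (K := K) v = (adicCompletionPrime K v).inertia (absoluteGaloisGroup K) := by
  rw [inertia_adicCompletionPrime_eq_map_absInertia]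
  rfl

/-- **`D_v = D_{𝔓₀}`**: the `GreenbergSelmer` decomposition group at `v` is the decomposition group (stabiliser) of `𝔓₀`.
[cite: NeukirchANT1999, Ch. II §9 Prop. (9.6)] -/
theorem decomp_eq_decompositionSubgroup_adicCompletionPrime :
    decomp (K := K) v = (adicCompletionPrime K v).decompositionSubgroup (absoluteGaloisGroup K) := by
  rw [decompositionSubgroup_adicCompletionPrime_eq_range]
  rfl

variable {v}

omit [NumberField K] in
/-- A conjugate of a prime above `v` is a prime above `v`. [cite: NeukirchANT1999, Ch. I §9 Prop. (9.1)] -/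
theorem smul_mem_primesAbove {𝔓 : Ideal (absIntegers (𝓞 K) K)} (h𝔓 : 𝔓 ∈ v.primesAbove) (τ : absoluteGaloisGroup K) :
    τ • 𝔓 ∈ v.primesAbove := by
  rw [HeightOneSpectrum.mem_primesAbove_iff] at h𝔓 ⊢
  obtain ⟨h1, h2⟩ := h𝔓
  exact ⟨Ideal.IsPrime.smul τ, Ideal.LiesOver.smul τ⟩

omit [NumberField K] in
/-- `n ∈ I_{τ • 𝔓} ⟹ τ⁻¹ n τ ∈ I_𝔓` (inertia groups of conjugate primes are conjugate). [cite: NeukirchANT1999, Ch. I §9 (9.4)] -/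
theorem conj_mem_inertia_of_mem {𝔓 : Ideal (absIntegers (𝓞 K) K)} {τ n : absoluteGaloisGroup K}
    (hn : n ∈ (τ • 𝔓).inertia (absoluteGaloisGroup K)) : τ⁻¹ * n * τ ∈ 𝔓.inertia (absoluteGaloisGroup K) :=
  DegreeOnePrimes.conj_mem_inertia_of_mem_inertia_smul hn

omit [NumberField K] in
set_option synthInstance.maxHeartbeats 100000 in
-- the pointwise `MulAction` of `Γ_K` on the ideals of `\bar ℤ_K` is found slowly under this file's imports
/-- `n ∈ D_{τ • 𝔓} ⟹ τ⁻¹ n τ ∈ D_𝔓` (decomposition groups of conjugate primes are conjugate). [cite: NeukirchANT1999, Ch. I §9 (9.4)] -/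
theorem conj_mem_decompositionSubgroup_of_mem {𝔓 : Ideal (absIntegers (𝓞 K) K)} {τ n : absoluteGaloisGroup K}
    (hn : n ∈ (τ • 𝔓).decompositionSubgroup (absoluteGaloisGroup K)) :
    τ⁻¹ * n * τ ∈ 𝔓.decompositionSubgroup (absoluteGaloisGroup K) := by
  rw [Ideal.decompositionSubgroup, MulAction.stabilizer_smul_eq_stabilizer_map_conj] at hn
  obtain ⟨m, hm, hmn⟩ := Subgroup.mem_map.1 hn
  have e : τ⁻¹ * n * τ = m := by
    rw [← hmn, MulEquiv.coe_toMonoidHom, MulAut.conj_apply]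
    group
  rw [e]
  exact hm

/-- **σ-form ⟹ prime-form (inertia).** If a predicate on `Γ_K` holds at every `n` some conjugate `σ n σ⁻¹` of which lies in
`I_v = inertia v`, then it holds at every `n` in the inertia group of ANY prime of `\bar ℤ_K` above `v` (all such primes are
conjugate to `𝔓₀`, `exists_smul_eq_of_mem_primesAbove_holds`, and `I_v = I_{𝔓₀}`). [cite: NeukirchANT1999, Ch. I §9 Prop. (9.1)]
[cite: NeukirchANT1999, Ch. II §9 Prop. (9.6)] -/
theorem forall_primesAbove_inertia_of_forall_conj (P : absoluteGaloisGroup K → Prop)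
    (h : ∀ σ n : absoluteGaloisGroup K, σ * n * σ⁻¹ ∈ inertia (K := K) v → P n)
    {𝔓 : Ideal (absIntegers (𝓞 K) K)} (h𝔓 : 𝔓 ∈ v.primesAbove) {n : absoluteGaloisGroup K}
    (hn : n ∈ 𝔓.inertia (absoluteGaloisGroup K)) : P n := by
  obtain ⟨τ, rfl⟩ := HeightOneSpectrum.exists_smul_eq_of_mem_primesAbove_holds
    (adicCompletionPrime_mem_primesAbove K v) h𝔓
  refine h τ⁻¹ n ?_
  rw [inv_inv, inertia_eq_inertia_adicCompletionPrime]
  exact conj_mem_inertia_of_mem hn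

/-- **σ-form ⟹ prime-form (decomposition).** Same with decomposition groups: a predicate holding at every `n` with some
`σ n σ⁻¹ ∈ D_v = decomp v` holds on `D_𝔓` for every prime `𝔓` above `v`. [cite: NeukirchANT1999, Ch. I §9 Prop. (9.1)]
[cite: NeukirchANT1999, Ch. II §9 Prop. (9.6)] -/
theorem forall_primesAbove_decompositionSubgroup_of_forall_conj (P : absoluteGaloisGroup K → Prop)
    (h : ∀ σ n : absoluteGaloisGroup K, σ * n * σ⁻¹ ∈ decomp (K := K) v → P n)
    {𝔓 : Ideal (absIntegers (𝓞 K) K)} (h𝔓 : 𝔓 ∈ v.primesAbove) {n : absoluteGaloisGroup K}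
    (hn : n ∈ 𝔓.decompositionSubgroup (absoluteGaloisGroup K)) : P n := by
  obtain ⟨τ, rfl⟩ := HeightOneSpectrum.exists_smul_eq_of_mem_primesAbove_holds
    (adicCompletionPrime_mem_primesAbove K v) h𝔓
  refine h τ⁻¹ n ?_
  rw [inv_inv, decomp_eq_decompositionSubgroup_adicCompletionPrime]
  exact conj_mem_decompositionSubgroup_of_mem hn

set_option synthInstance.maxHeartbeats 100000 in
-- the pointwise `MulAction` of `Γ_K` on the ideals of `\bar ℤ_K` is found slowly under this file's imports
/-- **prime-form ⟹ σ-form (inertia).** Conversely a predicate holding on `I_𝔓` for every prime `𝔓` above `v` holds at every `n`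
with some `σ n σ⁻¹ ∈ I_v` (`n ∈ I_{σ⁻¹ 𝔓₀}`). [cite: NeukirchANT1999, Ch. I §9 (9.4)] [cite: NeukirchANT1999, Ch. II §9 Prop. (9.6)] -/
theorem forall_conj_inertia_of_forall_primesAbove (P : absoluteGaloisGroup K → Prop)
    (h : ∀ 𝔓 ∈ v.primesAbove, ∀ n : absoluteGaloisGroup K, n ∈ 𝔓.inertia (absoluteGaloisGroup K) → P n)
    {σ n : absoluteGaloisGroup K} (hn : σ * n * σ⁻¹ ∈ inertia (K := K) v) : P n := by
  refine h (σ⁻¹ • adicCompletionPrime K v) (smul_mem_primesAbove (adicCompletionPrime_mem_primesAbove K v) σ⁻¹) n ?_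
  rw [inertia_eq_inertia_adicCompletionPrime] at hn
  have h' := conj_mem_inertia_of_mem (𝔓 := σ⁻¹ • adicCompletionPrime K v) (τ := σ) (n := σ * n * σ⁻¹)
    (by rwa [smul_inv_smul])
  simpa [mul_assoc] using h'

set_option synthInstance.maxHeartbeats 100000 in
-- the pointwise `MulAction` of `Γ_K` on the ideals of `\bar ℤ_K` is found slowly under this file's imports
/-- **prime-form ⟹ σ-form (decomposition).** [cite: NeukirchANT1999, Ch. I §9 (9.4)] [cite: NeukirchANT1999, Ch. II §9 Prop. (9.6)] -/
theorem forall_conj_decomp_of_forall_primesAbove (P : absoluteGaloisGroup K → Prop)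
    (h : ∀ 𝔓 ∈ v.primesAbove, ∀ n : absoluteGaloisGroup K, n ∈ 𝔓.decompositionSubgroup (absoluteGaloisGroup K) → P n)
    {σ n : absoluteGaloisGroup K} (hn : σ * n * σ⁻¹ ∈ decomp (K := K) v) : P n := by
  refine h (σ⁻¹ • adicCompletionPrime K v) (smul_mem_primesAbove (adicCompletionPrime_mem_primesAbove K v) σ⁻¹) n ?_
  rw [decomp_eq_decompositionSubgroup_adicCompletionPrime] at hn
  have h' := conj_mem_decompositionSubgroup_of_mem (𝔓 := σ⁻¹ • adicCompletionPrime K v) (τ := σ) (n := σ * n * σ⁻¹)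
    (by rwa [smul_inv_smul])
  simpa [mul_assoc] using h'

end Dictionary

/-! ## §2 The socket with local conditions at the primes of `\bar ℤ_K` -/

section Socket

variable {K : Type} [Field K] [NumberField K] {p : ℕ} [hp : Fact p.Prime]
variable (H : Subgroup (absoluteGaloisGroup K)) [H.Normal]
variable {M : Type} [AddCommGroup M] [DistribMulAction (absoluteGaloisGroup K) M] [TopologicalSpace M]
  [DiscreteTopology M]

/-- **THE SOCKET, `primesAbove` currency.** For `H ∋` every `g` (e.g. `κ.layerSubgroup 0`), `M` of prime order `p` with continuous
orbit maps and non-trivial action: **`datumStrictSelmer H M p (bdpData M p 𝔭) S₀ = ⊥`** as soon as every continuous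
`f : Γ_K → M`, additive and `Γ_K`-equivariant on `N = {n : n acts trivially}`, which kills `N ∩ I_𝔓` for every prime `𝔓` of
`\bar ℤ_K` above every finite `v ∉ S₀` with `v ∤ p` and `N ∩ D_𝔓` for every `𝔓` above `𝔭`, vanishes on `N` — i.e. «the
`[θ]`-isotypic continuous homomorphisms `Γ_L → M`, `L = K(M)`, unramified at the primes above `v ∉ S₀ ∪ {w ∣ p}` and split at the
primes above `𝔭` are zero» (M1 §2; Silverman's `Hom(G_L, M; S)`-currency). [cite: GreenbergLNM1716, §3 (PDF p. 86)]
[cite: SilvermanAEC2009, Lemma X.4.3 (proof)] [cite: NeukirchANT1999, Ch. II §9 Prop. (9.6)] -/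
theorem datumStrictSelmer_bdpData_eq_bot_of_forall_hom_primesAbove (hH : ∀ g : absoluteGaloisGroup K, g ∈ H)
    (hcard : Nat.card M = p) (hcont : ∀ m : M, Continuous fun g : absoluteGaloisGroup K ↦ g • m)
    (hnt : ∃ (σ : absoluteGaloisGroup K) (a : M), σ • a ≠ a)
    (𝔭 : HeightOneSpectrum (𝓞 K)) (h𝔭 : ((p : ℕ) : 𝓞 K) ∈ 𝔭.asIdeal) (S₀ : Set (HeightOneSpectrum (𝓞 K)))
    (hhom : ∀ f : absoluteGaloisGroup K → M, Continuous f →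
      (∀ a b : absoluteGaloisGroup K, (∀ m : M, a • m = m) → (∀ m : M, b • m = m) → f (a * b) = f a + f b) →
      (∀ g n : absoluteGaloisGroup K, (∀ m : M, n • m = m) → f (g * n * g⁻¹) = g • f n) →
      (∀ v : HeightOneSpectrum (𝓞 K), v ∉ S₀ → ((p : ℕ) : 𝓞 K) ∉ v.asIdeal →
        ∀ 𝔓 ∈ v.primesAbove, ∀ n : absoluteGaloisGroup K, (∀ m : M, n • m = m) →
          n ∈ 𝔓.inertia (absoluteGaloisGroup K) → f n = 0) →
      (∀ 𝔓 ∈ 𝔭.primesAbove, ∀ n : absoluteGaloisGroup K, (∀ m : M, n • m = m) →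
          n ∈ 𝔓.decompositionSubgroup (absoluteGaloisGroup K) → f n = 0) →
      ∀ n : absoluteGaloisGroup K, (∀ m : M, n • m = m) → f n = 0) :
    datumStrictSelmer H M p (AcSelmer.bdpData M p 𝔭) S₀ = ⊥ :=
  datumStrictSelmer_bdpData_eq_bot_of_forall_hom_of_top H hH hcard hcont hnt 𝔭 h𝔭 S₀
    fun f hf hadd hconj hU hS ↦ hhom f hf hadd hconj
      (fun v hv hpv _ h𝔓 _ hn hnI ↦ forall_primesAbove_inertia_of_forall_conj
        (fun n ↦ (∀ m : M, n • m = m) → f n = 0) (fun σ n hσ hn' ↦ hU v hv hpv σ n hn' hσ) h𝔓 hnI hn)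
      (fun _ h𝔓 _ hn hnD ↦ forall_primesAbove_decompositionSubgroup_of_forall_conj
        (fun n ↦ (∀ m : M, n • m = m) → f n = 0) (fun σ n hσ hn' ↦ hS σ n hn' hσ) h𝔓 hnD hn)

/-- **THE SOCKET, `primesAbove` + CHARACTER currency**: the same with `f : Γ_K → ℤ/p`, `N = ker θ` for the character `θ` of `M`
(`g • m = θ(g) • m`, `θ g = 1 ↔ g acts trivially`), equivariance `f(g n g⁻¹) = θ(g) f(n)`. [cite: GreenbergLNM1716, §3 (PDF p. 86)]
[cite: SilvermanAEC2009, Lemma X.4.3 (proof)] [cite: NeukirchANT1999, Ch. II §9 Prop. (9.6)] -/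
theorem datumStrictSelmer_bdpData_eq_bot_of_forall_hom_character_primesAbove (hH : ∀ g : absoluteGaloisGroup K, g ∈ H)
    (hcard : Nat.card M = p) (hcont : ∀ m : M, Continuous fun g : absoluteGaloisGroup K ↦ g • m)
    (hnt : ∃ (σ : absoluteGaloisGroup K) (a : M), σ • a ≠ a)
    (θ : absoluteGaloisGroup K →* (ZMod p)ˣ)
    (hθ : ∀ (g : absoluteGaloisGroup K) (m : M), g • m = (((θ g : ZMod p).val : ℕ) : ℤ) • m)
    (hker : ∀ g : absoluteGaloisGroup K, θ g = 1 ↔ ∀ m : M, g • m = m)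
    (𝔭 : HeightOneSpectrum (𝓞 K)) (h𝔭 : ((p : ℕ) : 𝓞 K) ∈ 𝔭.asIdeal) (S₀ : Set (HeightOneSpectrum (𝓞 K)))
    (hhom : ∀ f : absoluteGaloisGroup K → ZMod p, Continuous f →
      (∀ a b : absoluteGaloisGroup K, θ a = 1 → θ b = 1 → f (a * b) = f a + f b) →
      (∀ g n : absoluteGaloisGroup K, θ n = 1 → f (g * n * g⁻¹) = (θ g : ZMod p) * f n) →
      (∀ v : HeightOneSpectrum (𝓞 K), v ∉ S₀ → ((p : ℕ) : 𝓞 K) ∉ v.asIdeal →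
        ∀ 𝔓 ∈ v.primesAbove, ∀ n : absoluteGaloisGroup K, θ n = 1 →
          n ∈ 𝔓.inertia (absoluteGaloisGroup K) → f n = 0) →
      (∀ 𝔓 ∈ 𝔭.primesAbove, ∀ n : absoluteGaloisGroup K, θ n = 1 →
          n ∈ 𝔓.decompositionSubgroup (absoluteGaloisGroup K) → f n = 0) →
      ∀ n : absoluteGaloisGroup K, θ n = 1 → f n = 0) :
    datumStrictSelmer H M p (AcSelmer.bdpData M p 𝔭) S₀ = ⊥ :=
  datumStrictSelmer_bdpData_eq_bot_of_forall_hom_character H hH hcard hcont hnt θ hθ hker 𝔭 h𝔭 S₀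
    fun f hf hadd hconj hU hS ↦ hhom f hf hadd hconj
      (fun v hv hpv _ h𝔓 _ hn hnI ↦ forall_primesAbove_inertia_of_forall_conj
        (fun n ↦ θ n = 1 → f n = 0) (fun σ n hσ hn' ↦ hU v hv hpv σ n hn' hσ) h𝔓 hnI hn)
      (fun _ h𝔓 _ hn hnD ↦ forall_primesAbove_decompositionSubgroup_of_forall_conj
        (fun n ↦ θ n = 1 → f n = 0) (fun σ n hσ hn' ↦ hS σ n hn' hσ) h𝔓 hnD hn)

end Socket

/-! ## §3 On the class, with Stub H's quantifiers, `primesAbove` + character currency -/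

section Class

variable {p : ℕ} [hp : Fact p.Prime]

/-- **Stub H's `Φ`-conjunct, `primesAbove` + character currency.** For `W/ℚ` CM, `p ≥ 5` CM-ramified, `K` quadratic, `κ`,
`𝔭 ∋ p`, ANY stable line `Φ ≤ W_K[p]` of order `p` with character `θ` (T2 `exists_character_of_card_prime`; T1: `θ ≐ ψ̄|` or
`ψ̄⁻¹ω̄|`), ANY `S₀`: `datumStrictSelmer (κ.layerSubgroup 0) Φ.Sub p (bdpData Φ.Sub p 𝔭) S₀ = ⊥` as soon as every continuous
`f : Γ_K → ℤ/p`, additive on `ker θ` with `f(g n g⁻¹) = θ(g) f(n)`, killing `ker θ ∩ I_𝔓` for every prime `𝔓` of `\bar ℤ_K`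
above every `v ∉ S₀`, `v ∤ p`, and `ker θ ∩ D_𝔓` for every `𝔓` above `𝔭`, vanishes on `ker θ`.
[cite: GreenbergLNM1716, §3 (PDF p. 86)] [cite: KrizLi2019, p. 3 («relative p-class numbers»)] [cite: NeukirchANT1999, Ch. II §9 Prop. (9.6)] -/
theorem bottomResidualSelmer_sub_eq_bot_of_forall_hom_character_primesAbove (W : WeierstrassCurve ℚ) [W.IsElliptic]
    (hCM : W.HasCM) (hram : Rank1Residual.CMRamified W p) (h5 : 5 ≤ p) (K : Type) [Field K] [NumberField K]
    (hK2 : Module.finrank ℚ K = 2) (κ : ZpExtension K p) (𝔭 : HeightOneSpectrum (𝓞 K))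
    (h𝔭 : ((p : ℕ) : 𝓞 K) ∈ 𝔭.asIdeal) (S₀ : Set (HeightOneSpectrum (𝓞 K)))
    (Φ : X2.ResidualDevissageModules.StableSubgroup (absoluteGaloisGroup K) ((W.baseChange K).geomTorsion (p : ℤ)))
    (hcard : Nat.card Φ.Sub = p) (θ : absoluteGaloisGroup K →* (ZMod p)ˣ)
    (hθ : ∀ (g : absoluteGaloisGroup K) (x : Φ.Sub), g • x = (((θ g : ZMod p).val : ℕ) : ℤ) • x)
    (hker : ∀ g : absoluteGaloisGroup K, θ g = 1 ↔ ∀ x : Φ.Sub, g • x = x)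
    (hhom : ∀ f : absoluteGaloisGroup K → ZMod p, Continuous f →
      (∀ a b : absoluteGaloisGroup K, θ a = 1 → θ b = 1 → f (a * b) = f a + f b) →
      (∀ g n : absoluteGaloisGroup K, θ n = 1 → f (g * n * g⁻¹) = (θ g : ZMod p) * f n) →
      (∀ v : HeightOneSpectrum (𝓞 K), v ∉ S₀ → ((p : ℕ) : 𝓞 K) ∉ v.asIdeal →
        ∀ 𝔓 ∈ v.primesAbove, ∀ n : absoluteGaloisGroup K, θ n = 1 →
          n ∈ 𝔓.inertia (absoluteGaloisGroup K) → f n = 0) →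
      (∀ 𝔓 ∈ 𝔭.primesAbove, ∀ n : absoluteGaloisGroup K, θ n = 1 →
          n ∈ 𝔓.decompositionSubgroup (absoluteGaloisGroup K) → f n = 0) →
      ∀ n : absoluteGaloisGroup K, θ n = 1 → f n = 0) :
    datumStrictSelmer (κ.layerSubgroup 0) Φ.Sub p (AcSelmer.bdpData Φ.Sub p 𝔭) S₀ = ⊥ := by
  haveI hE : (W.baseChange K).IsElliptic := by unfold WeierstrassCurve.baseChange; infer_instance
  exact datumStrictSelmer_bdpData_eq_bot_of_forall_hom_character_primesAbove (κ.layerSubgroup 0)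
    (fun g ↦ by rw [ZpExtension.layerSubgroup_zero]; exact Subgroup.mem_top g) hcard
    (Φ.continuous_smul_sub (HerbrandLineRestriction.continuous_smul_geomTorsion (W.baseChange K) (p : ℤ)))
    (exists_smul_ne_sub_of_cmRamified W hCM hram h5 K hK2 Φ hcard).1 θ hθ hker 𝔭 h𝔭 S₀ hhom

/-- **Stub H's `W[p]/Φ`-conjunct, `primesAbove` + character currency** (character `θ'` of the quotient line, `θθ' = χ̄_p ∘ res`).
[cite: GreenbergLNM1716, §3 (PDF p. 86)] [cite: GreenbergVatsal2000, §2 pp. 16–17] [cite: NeukirchANT1999, Ch. II §9 Prop. (9.6)] -/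
theorem bottomResidualSelmer_quot_eq_bot_of_forall_hom_character_primesAbove (W : WeierstrassCurve ℚ) [W.IsElliptic]
    (hCM : W.HasCM) (hram : Rank1Residual.CMRamified W p) (h5 : 5 ≤ p) (K : Type) [Field K] [NumberField K]
    (hK2 : Module.finrank ℚ K = 2) (κ : ZpExtension K p) (𝔭 : HeightOneSpectrum (𝓞 K))
    (h𝔭 : ((p : ℕ) : 𝓞 K) ∈ 𝔭.asIdeal) (S₀ : Set (HeightOneSpectrum (𝓞 K)))
    (Φ : X2.ResidualDevissageModules.StableSubgroup (absoluteGaloisGroup K) ((W.baseChange K).geomTorsion (p : ℤ)))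
    (hcard : Nat.card Φ.Sub = p) (θ' : absoluteGaloisGroup K →* (ZMod p)ˣ)
    (hθ' : ∀ (g : absoluteGaloisGroup K) (y : Φ.Quot), g • y = (((θ' g : ZMod p).val : ℕ) : ℤ) • y)
    (hker' : ∀ g : absoluteGaloisGroup K, θ' g = 1 ↔ ∀ y : Φ.Quot, g • y = y)
    (hhom : ∀ f : absoluteGaloisGroup K → ZMod p, Continuous f →
      (∀ a b : absoluteGaloisGroup K, θ' a = 1 → θ' b = 1 → f (a * b) = f a + f b) →
      (∀ g n : absoluteGaloisGroup K, θ' n = 1 → f (g * n * g⁻¹) = (θ' g : ZMod p) * f n) →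
      (∀ v : HeightOneSpectrum (𝓞 K), v ∉ S₀ → ((p : ℕ) : 𝓞 K) ∉ v.asIdeal →
        ∀ 𝔓 ∈ v.primesAbove, ∀ n : absoluteGaloisGroup K, θ' n = 1 →
          n ∈ 𝔓.inertia (absoluteGaloisGroup K) → f n = 0) →
      (∀ 𝔓 ∈ 𝔭.primesAbove, ∀ n : absoluteGaloisGroup K, θ' n = 1 →
          n ∈ 𝔓.decompositionSubgroup (absoluteGaloisGroup K) → f n = 0) →
      ∀ n : absoluteGaloisGroup K, θ' n = 1 → f n = 0) :
    datumStrictSelmer (κ.layerSubgroup 0) Φ.Quot p (AcSelmer.bdpData Φ.Quot p 𝔭) S₀ = ⊥ := by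
  haveI hE : (W.baseChange K).IsElliptic := by unfold WeierstrassCurve.baseChange; infer_instance
  exact datumStrictSelmer_bdpData_eq_bot_of_forall_hom_character_primesAbove (κ.layerSubgroup 0)
    (fun g ↦ by rw [ZpExtension.layerSubgroup_zero]; exact Subgroup.mem_top g)
    (HerbrandLineRestriction.natCard_quot_eq_of_card_sub (W.baseChange K) Φ hcard)
    (Φ.continuous_smul_quot (HerbrandLineRestriction.continuous_smul_geomTorsion (W.baseChange K) (p : ℤ)))
    (exists_smul_ne_sub_of_cmRamified W hCM hram h5 K hK2 Φ hcard).2 θ' hθ' hker' 𝔭 h𝔭 S₀ hhom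

end Class

end Summit.BirchSwinnertonDyer.BirchSwinnertonDyer.Theorems.PrintCFram.HerbrandSelmerToHom

end
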